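import Mathlib
import HarnessLib

/-!
# S1a — R4e preliminaries: a section congruent to a unit modulo sections vanishing at `x` is invertible at `x`

[OURS · L1 W4.5c · lead-1 g16; plan-1 RULING R-F15p ★ R4e-rational — discharges the hypothesis `hZW : V_O(e⁻¹x_v) ∩ O ⊆ D(e⁻¹hh)` of ✓`exists_pointCentre_away₀`
for `hh ≡ c (mod x₀, x₁)` with `c ∈ k×` (`hh = ∏_{j≠i} N(x₁ + αᵢ − αⱼ)`)] — NOT statements of the manuscript; counted 0; AI-level work, weaker than expert review.
Crux stmt-ResolutionOfSingularities-17941 `CyclicQuotientFourfolds`, line `s1a-logminvertex` v13 (`stub_reachLowerInFX`).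

* `Scheme.mem_basicOpen_of_sub_mem_span` — `s − t ∈ (S)`, `x ∈ V(S) ∩ D(t)` ⇒ `x ∈ D(s)` (the stalk is local);
* `Scheme.zeroLocus_inter_subset_basicOpen_of_sub_C_mem_span` — polynomial-chart form: `e⁻¹`-images, `hh − C c ∈ span (X ∘ v)`, `c ≠ 0`;
* `Scheme.closure_zeroLocus_inter_subset_of_cover_of_subset` — closure of a chart zero set inside a UNION of charts (closed-set input `B` of the multi-chart gluing).
-/

set_option linter.dupNamespace false

noncomputable section

open CategoryTheory AlgebraicGeometry TopologicalSpace Opposite MvPolynomial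

namespace AlgebraicGeometry.Scheme

/-- **A section congruent to a unit modulo sections vanishing at `x` is a unit at `x`.** [folklore] -/
theorem mem_basicOpen_of_sub_mem_span {X : Scheme} {U : X.Opens} (S : Set Γ(X, U)) (s t : Γ(X, U)) (h : s - t ∈ Ideal.span S)
    {x : X} (hxU : x ∈ U) (hx : x ∈ X.zeroLocus (U := U) S) (ht : x ∈ X.basicOpen t) : x ∈ X.basicOpen s := by
  rw [Scheme.mem_basicOpen _ _ _ hxU] at ht ⊢
  have hS : (Ideal.span S).map (X.presheaf.germ U x hxU).hom ≤ IsLocalRing.maximalIdeal (X.presheaf.stalk x) := by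
    rw [Ideal.map_le_iff_le_comap, Ideal.span_le]
    intro g hg
    rw [SetLike.mem_coe, Ideal.mem_comap, IsLocalRing.mem_maximalIdeal, mem_nonunits_iff]
    have hxg := (Scheme.mem_zeroLocus_iff _ _ _).mp hx g hg
    rwa [Scheme.mem_basicOpen _ _ _ hxU] at hxg
  have hm : (X.presheaf.germ U x hxU).hom s - (X.presheaf.germ U x hxU).hom t ∈ IsLocalRing.maximalIdeal (X.presheaf.stalk x) := by
    rw [← map_sub]
    exact hS (Ideal.mem_map_of_mem _ h)
  by_contra hs
  have hs' : (X.presheaf.germ U x hxU).hom s ∈ IsLocalRing.maximalIdeal (X.presheaf.stalk x) :=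
    (IsLocalRing.mem_maximalIdeal _).mpr hs
  have ht' : (X.presheaf.germ U x hxU).hom t ∈ IsLocalRing.maximalIdeal (X.presheaf.stalk x) := by
    have := Ideal.sub_mem _ hs' hm
    rwa [sub_sub_cancel] at this
  exact (IsLocalRing.mem_maximalIdeal _).mp ht' ht

/-- **Polynomial-chart form**: for `e : Γ(Y, U) ≃ k[x_ι]`, `hh − C c ∈ (x_{v i})` with `c ≠ 0`, the zero set `V_U(e⁻¹x_v) ∩ U` lies in `D(e⁻¹hh)`. [folklore] -/
theorem zeroLocus_inter_subset_basicOpen_of_sub_C_mem_span {Y : Scheme} {U : Y.Opens} {k : Type} [Field k] {ι : Type} (e : Γ(Y, U) ≃+* MvPolynomial ι k)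
    {c' : ℕ} (v : Fin c' → ι) (hh : MvPolynomial ι k) (c : k) (hc : c ≠ 0)
    (h : hh - C c ∈ Ideal.span (Set.range ((MvPolynomial.X : ι → MvPolynomial ι k) ∘ v))) :
    Y.zeroLocus (U := U) (Set.range (e.symm ∘ (MvPolynomial.X : ι → MvPolynomial ι k) ∘ v)) ∩ (U : Set Y) ⊆ (Y.basicOpen (e.symm hh) : Set Y) := by
  rintro x ⟨hxZ, hxU⟩
  have hunit : IsUnit (e.symm (C c)) := ((isUnit_iff_ne_zero.mpr hc).map C).map e.symm
  refine mem_basicOpen_of_sub_mem_span _ (e.symm hh) (e.symm (C c)) ?_ hxU hxZ ?_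
  · rw [← map_sub]
    have hmap := Ideal.mem_map_of_mem (e.symm : MvPolynomial ι k →+* Γ(Y, U)) h
    rw [Ideal.map_span, ← Set.range_comp] at hmap
    exact hmap
  · rw [Y.basicOpen_of_isUnit hunit]
    exact hxU

/-- **Closure of a chart zero set inside a union of charts**: if `V` is covered by `T` and opens `U i`, and for each `i` a section `t i ∈ Γ(V, W)` has a positive power
in `S` and is invertible on `W ∩ U i`, then `closure (V_W(S) ∩ W) ⊆ T` (✓`closure_zeroLocus_inter_subset_of_cover` is the case `T = W`). [folklore] -/
theorem closure_zeroLocus_inter_subset_of_cover_of_subset {Y : Scheme} (W : Y.Opens) (T : Set Y) {ι : Type*} (U : ι → Y.Opens)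
    (hcov : ∀ x : Y, x ∈ T ∨ ∃ i, x ∈ U i) (S : Set Γ(Y, W)) (t : ι → Γ(Y, W))
    (htS : ∀ i, ∃ n : ℕ, 0 < n ∧ t i ^ n ∈ S) (htU : ∀ i, ∀ v ∈ W, v ∈ U i → v ∈ Y.basicOpen (t i)) :
    closure (Y.zeroLocus (U := W) S ∩ (W : Set Y)) ⊆ T := by
  intro x hx
  rcases hcov x with hxT | ⟨i, hxi⟩
  · exact hxT
  · exfalso
    obtain ⟨v, hvi, hvZ, hvW⟩ := mem_closure_iff.mp hx (U i) (U i).isOpen hxi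
    obtain ⟨n, hn, hnS⟩ := htS i
    have hvt : v ∉ Y.basicOpen (t i) := by
      have := (Scheme.mem_zeroLocus_iff _ _ _).mp hvZ _ hnS
      rwa [Scheme.basicOpen_pow _ _ hn] at this
    exact hvt (htU i v hvW hvi)

end AlgebraicGeometry.Scheme

end
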